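import Summits.CriticalPhenomena.PercolationContinuityZ3.Theorems.PercNearOneGluingNoHeavyQuantLightPairBlobForest
import HarnessLib

/-!
# QUANT lane R8, T-DEC: THE LIGHT GLUED PAIR, LEFT BAND — closed-form certificate by four ungated blob forests and one floor-tight gated
# blob forest for `T = (R¹[q](R^c[s]))²` on the explicit region `R_BFleft(c)` (pattern `G` of census-2 g77's exact LP map: small `s`, `q ≤ 2/(2+cs)`)

builds on p205010 (kernel theorem, internal audit signed; external expert review pending)

Support file (`--supports stmt-CriticalPhenomena-4575`), QUANT lane census seat prim-quant-census-2 (gen 77), rung R8 of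
`run/shared/lean/prim/quant/LADDER.md`.  Theorems only (no definition, no conjecture); standard axioms, no sorries.  Sequel of
`…QuantLightPairBlobForest` / `…Low` / `…Mid` (patterns `M`, `H`, `I`).

WHAT.  With `T = 2q(1+cs)`, floor `y = qs`, `D = 2 + cs − 2s`, `u = q(2+cs)/2`:
  `T = w₁·[δ₁ ∗ blob(c, (T−1)/c)] + w₂·[δ₁ ∗ blob(c+1, (T−1)/(c+1))] + w₃·[δ₁ ∗ blob(2c+1, (T−1)/(2c+1))] + w₅·blob(c+1, T/(c+1)) + w₇·gate_u(δ₂ ∗ blob(c, 2s/(2+cs)))`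
(the last column FLOOR-TIGHT: blob marginal `u·2s/(2+cs) = qs`; it is the only column charging atom `2`),
  `w₇ = 2q(1−s)²/D`, `w₃ = q²s²(2c+1)/(T−1)`, `w₂ = 2(c+1)q²s(1−s)(1+cs−s)/(D(T−1))`,
  `w₅ = (c+1)·N₅/(D(c+1−T))`, `N₅ = (1−q)²D − 2q(1−s)²(1−u)`;  `w₁ = c·N₁/((T−1)D(c+1−T))`, `N₁ = 2q(1−q)s(c+1−T)D − T·N₅`
— valid EXACTLY on `R_BFleft(c) = { 1 ≤ c, 1/2 < q < 1, 0 < s < 1, T < c+1, qs ≤ 2q−1, q(2+cs) ≤ 2, N₅ ≥ 0, N₁ ≥ 0 }` (exact scan: the identity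
holds at all 17 147 grid points off the poles and the inequality list = certificate validity; `c ≤ 20`); e.g. `c = 4`: `q = .6, s ∈ [.1, .2]`;
`q = .7, s ∈ [.1, .2]`; `q = .8, s ≈ .1`; `q = .55, s ∈ [.05, .15]` — the band between the light-root strip (`T ≤ 2`, ✓ `…QuantLightPairLightRoot`)
and pattern `I`.
* `lpT_eq_bfLeftMix` (pointwise identity off the poles); **`lpT_inGatedCatHull_bfLeft`**; `_below`, `sdec_lpT_bfLeft`, **`treeBuiltCatHull_lpT_bfLeft`**.
HONEST STATUS.  Instances on an explicit region only; `TreeBuiltCatHullLight`, `CatPairLight`, `SiblingStep`, `FarTreeRow` remain OPEN; RATE class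
log\* / honest sentence of `run/shared/lean/prim/quant/README.md` unchanged.  [this work]; `lpT`: prim-quant-census-2 g76.  Nothing here is cited as
a published result.  The gluing rows served [cite: KozmaNitzan2024, Conjecture 3 (p. 15)]; product measure [cite: Grimmett1999, §1.3 p. 10].
-/

noncomputable section

open scoped BigOperators

namespace Summit.CriticalPhenomena.PercolationContinuityZ3.Theorems
namespace Quant
namespace LawDec

open Finset

/-! ### The closed-form identity -/

/-- value form of a gated blob-forest column `gate (blobLaw [(a, g), (n, 1)]) u` (sure `n`-block). [this work] -/
theorem gate_blobLaw_pair_sureN_apply (a n : ℕ) (g u : ℝ) (h : ℕ) :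
    gate (blobLaw [(a, g), (n, 1)]) u h = u * ((1 - g) * pointLaw n h + g * pointLaw (a + n) h) + (1 - u) * pointLaw 0 h := by
  rw [gate_apply, blobLaw_pair_sure_apply, show (if h = 0 then (1 : ℝ) else 0) = pointLaw 0 h from (pointLaw_apply 0 h).symm]

/-- **THE IDENTITY OF PATTERN `G`** (pointwise; `c ≠ 0`, off the poles `T ≠ 1, c+1`, `2 + cs − 2s ≠ 0`, `2 + cs ≠ 0`; `T = 2q(1+cs)`). [this work] -/
theorem lpT_eq_bfLeftMix (c : ℕ) (q s : ℝ) (hc0 : (c : ℝ) ≠ 0) (hW : 2 * q * (1 + c * s) - 1 ≠ 0)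
    (hU : (c : ℝ) + 1 - 2 * q * (1 + c * s) ≠ 0) (hD : (2 : ℝ) + c * s - 2 * s ≠ 0) (hP : (2 : ℝ) + c * s ≠ 0) (h : ℕ) :
    lpT c q s h =
      (c * (2 * q * (1 - q) * s * (c + 1 - 2 * q * (1 + c * s)) * (2 + c * s - 2 * s) -
              2 * q * (1 + c * s) * ((1 - q) ^ 2 * (2 + c * s - 2 * s) - 2 * q * (1 - s) ^ 2 * (1 - q * (2 + c * s) / 2))) /
            ((2 * q * (1 + c * s) - 1) * (2 + c * s - 2 * s) * (c + 1 - 2 * q * (1 + c * s)))) *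
          blobLaw [(c, (2 * q * (1 + c * s) - 1) / c), (1, 1)] h +
        (2 * (c + 1) * q ^ 2 * s * (1 - s) * (1 + c * s - s) / ((2 + c * s - 2 * s) * (2 * q * (1 + c * s) - 1))) *
          blobLaw [(c + 1, (2 * q * (1 + c * s) - 1) / (c + 1)), (1, 1)] h +
        (q ^ 2 * s ^ 2 * (2 * c + 1) / (2 * q * (1 + c * s) - 1)) *
          blobLaw [(2 * c + 1, (2 * q * (1 + c * s) - 1) / (2 * c + 1)), (1, 1)] h +
        ((c + 1) * ((1 - q) ^ 2 * (2 + c * s - 2 * s) - 2 * q * (1 - s) ^ 2 * (1 - q * (2 + c * s) / 2)) /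
            ((2 + c * s - 2 * s) * (c + 1 - 2 * q * (1 + c * s)))) *
          blobLaw [(c + 1, 2 * q * (1 + c * s) / (c + 1))] h +
        (2 * q * (1 - s) ^ 2 / (2 + c * s - 2 * s)) * gate (blobLaw [(c, 2 * s / (2 + c * s)), (2, 1)]) (q * (2 + c * s) / 2) h := by
  have hc1 : (c : ℝ) + 1 ≠ 0 := by positivity
  have hc2 : (2 : ℝ) * c + 1 ≠ 0 := by positivity
  rw [lpT_apply, blobLaw_pair_sure_apply, blobLaw_pair_sure_apply, blobLaw_pair_sure_apply, blobLaw_one_apply, gate_blobLaw_pair_sureN_apply,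
    show c + 1 + 1 = c + 2 by ring, show 2 * c + 1 + 1 = 2 * c + 2 by ring]
  generalize eT : 2 * q * (1 + (c : ℝ) * s) = T at hW hU ⊢
  generalize eP : (2 : ℝ) + (c : ℝ) * s = P at hD hP ⊢
  generalize eW : T - 1 = W at hW ⊢
  generalize eU : (c : ℝ) + 1 - T = U at hU ⊢
  generalize eD : P - 2 * s = D at hD ⊢
  field_simp
  subst eW eU eD eT eP
  ring

/-! ### Membership on the region `R_BFleft(c)` -/

set_option maxHeartbeats 400000 in
/-- **THE LIGHT GLUED PAIR IS IN THE HULL ON `R_BFleft(c)`**: for `1 ≤ c`, `1/2 < q < 1`, `0 < s < 1` with `T := 2q(1+cs) < c + 1`,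
`qs ≤ 2q − 1`, `q(2+cs) ≤ 2`, `N₅ := (1−q)²(2+cs−2s) − 2q(1−s)²(1 − q(2+cs)/2) ≥ 0` and `2q(1−q)s(c+1−T)(2+cs−2s) − T·N₅ ≥ 0`:
`InGatedCatHull (qs) T (2c+2) (lpT c q s)`. [this work] -/
theorem lpT_inGatedCatHull_bfLeft (c : ℕ) (q s : ℝ) (hc : 1 ≤ c) (hq : 1 / 2 < q) (hq1 : q < 1) (hs0 : 0 < s) (hs1 : s < 1)
    (hT : 2 * q * (1 + c * s) < c + 1) (hB : q * s ≤ 2 * q - 1) (hu : q * (2 + c * s) ≤ 2)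
    (hN5 : 0 ≤ (1 - q) ^ 2 * (2 + c * s - 2 * s) - 2 * q * (1 - s) ^ 2 * (1 - q * (2 + c * s) / 2))
    (hN1 : 0 ≤ 2 * q * (1 - q) * s * (c + 1 - 2 * q * (1 + c * s)) * (2 + c * s - 2 * s) -
      2 * q * (1 + c * s) * ((1 - q) ^ 2 * (2 + c * s - 2 * s) - 2 * q * (1 - s) ^ 2 * (1 - q * (2 + c * s) / 2))) :
    InGatedCatHull (q * s) (2 * q * (1 + c * s)) (2 * c + 2) (lpT c q s) := by
  have hc0' : (0 : ℝ) < c := by exact_mod_cast hc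
  have hc0 : (c : ℝ) ≠ 0 := hc0'.ne'
  have hq0 : 0 < q := by linarith
  have hy0 : 0 < q * s := by nlinarith
  have hy1 : q * s < 1 := by nlinarith
  set T := 2 * q * (1 + c * s) with hTdef
  have hT1 : 1 < T := by
    have : 0 < 2 * q * (c * s) := by positivity
    rw [hTdef]; nlinarith
  have hU : 0 < (c : ℝ) + 1 - T := by linarith
  have hW : 0 < T - 1 := by linarith
  have hcs : 0 ≤ (c : ℝ) * s := by positivity
  have hD : 0 < (2 : ℝ) + c * s - 2 * s := by nlinarith
  have hP : 0 < (2 : ℝ) + c * s := by linarith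
  have m1 : InGatedCatHull (q * s) T (2 * c + 2) (blobLaw [(c, (T - 1) / c), (1, 1)]) := by
    have g := inGatedCatHull_blobLaw (q * s) hy0 hy1 [(c, (T - 1) / c), (1, 1)] (fun p hp => by
      simp only [List.mem_cons, List.not_mem_nil, or_false] at hp
      rcases hp with rfl | rfl
      · refine ⟨?_, ?_⟩
        · rw [le_div_iff₀ hc0']; rw [hTdef]; nlinarith
        · rw [div_le_one hc0']; linarith
      · exact ⟨hy1.le, le_rfl⟩) (M := 2 * c + 2) (by simp only [blobTop]; omega)
    have e : blobMean [(c, (T - 1) / c), (1, 1)] = T := by simp only [blobMean]; push_cast; field_simp; ring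
    rwa [e] at g
  have m2 : InGatedCatHull (q * s) T (2 * c + 2) (blobLaw [(c + 1, (T - 1) / (c + 1)), (1, 1)]) := by
    have hc1 : (0 : ℝ) < c + 1 := by positivity
    have g := inGatedCatHull_blobLaw (q * s) hy0 hy1 [(c + 1, (T - 1) / (c + 1)), (1, 1)] (fun p hp => by
      simp only [List.mem_cons, List.not_mem_nil, or_false] at hp
      rcases hp with rfl | rfl
      · refine ⟨?_, ?_⟩
        · show q * s ≤ (T - 1) / (c + 1)
          rw [le_div_iff₀ hc1, hTdef]
          have : 0 ≤ (c - 1 : ℝ) * (q * s) := mul_nonneg (by linarith [show (1 : ℝ) ≤ c by exact_mod_cast hc]) hy0.le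
          nlinarith
        · show (T - 1) / (c + 1) ≤ 1
          rw [div_le_one hc1]; linarith
      · exact ⟨hy1.le, le_rfl⟩) (M := 2 * c + 2) (by simp only [blobTop]; omega)
    have e : blobMean [(c + 1, (T - 1) / (c + 1)), (1, 1)] = T := by
      simp only [blobMean]; push_cast; field_simp; ring
    rwa [e] at g
  have m3 : InGatedCatHull (q * s) T (2 * c + 2) (blobLaw [(2 * c + 1, (T - 1) / (2 * c + 1)), (1, 1)]) := by
    have hc2 : (0 : ℝ) < 2 * c + 1 := by positivity
    have g := inGatedCatHull_blobLaw (q * s) hy0 hy1 [(2 * c + 1, (T - 1) / (2 * c + 1)), (1, 1)] (fun p hp => by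
      simp only [List.mem_cons, List.not_mem_nil, or_false] at hp
      rcases hp with rfl | rfl
      · refine ⟨?_, ?_⟩
        · show q * s ≤ (T - 1) / (2 * c + 1)
          rw [le_div_iff₀ hc2, hTdef]; nlinarith
        · show (T - 1) / (2 * c + 1) ≤ 1
          rw [div_le_one hc2]; linarith
      · exact ⟨hy1.le, le_rfl⟩) (M := 2 * c + 2) (by simp only [blobTop]; omega)
    have e : blobMean [(2 * c + 1, (T - 1) / (2 * c + 1)), (1, 1)] = T := by
      simp only [blobMean]; push_cast; field_simp; ring
    rwa [e] at g
  have m5 : InGatedCatHull (q * s) T (2 * c + 2) (blobLaw [(c + 1, T / (c + 1))]) := by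
    have hc1 : (0 : ℝ) < c + 1 := by positivity
    have g := inGatedCatHull_blobLaw (q * s) hy0 hy1 [(c + 1, T / (c + 1))] (fun p hp => by
      simp only [List.mem_cons, List.not_mem_nil, or_false] at hp
      subst hp
      refine ⟨?_, ?_⟩
      · show q * s ≤ T / (c + 1)
        rw [le_div_iff₀ hc1, hTdef]; nlinarith
      · show T / (c + 1) ≤ 1
        rw [div_le_one hc1]; linarith) (M := 2 * c + 2) (by simp only [blobTop]; omega)
    have e : blobMean [(c + 1, T / (c + 1))] = T := by simp only [blobMean]; push_cast; field_simp; ring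
    rwa [e] at g
  -- the floor-tight gated column `gate_{q(2+cs)/2}(δ₂ ∗ blob(c, 2s/(2+cs)))`
  have hg : 0 < 2 * s / (2 + c * s) := div_pos (by linarith) hP
  have hg1 : 2 * s / (2 + c * s) < 1 := by rw [div_lt_one hP]; nlinarith
  have hu0 : 0 < q * (2 + c * s) / 2 := by positivity
  have hu1 : q * (2 + c * s) / 2 ≤ 1 := by linarith
  have m7 : InGatedCatHull (q * s) T (2 * c + 2) (gate (blobLaw [(c, 2 * s / (2 + c * s)), (2, 1)]) (q * (2 + c * s) / 2)) := by
    have g := inGatedCatHull_blobLaw (2 * s / (2 + c * s)) hg hg1 [(c, 2 * s / (2 + c * s)), (2, 1)] (fun p hp => by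
      simp only [List.mem_cons, List.not_mem_nil, or_false] at hp
      rcases hp with rfl | rfl
      · exact ⟨le_rfl, hg1.le⟩
      · exact ⟨hg1.le, le_rfl⟩) (M := 2 * c + 2) (by simp only [blobTop]; omega)
    have g2 := inGatedCatHull_gate g hg.le (q * (2 + c * s) / 2) hu0 hu1
    have e1 : q * (2 + c * s) / 2 * (2 * s / (2 + c * s)) = q * s := by field_simp
    have e2 : q * (2 + c * s) / 2 * blobMean [(c, 2 * s / (2 + c * s)), (2, 1)] = T := by
      simp only [blobMean]; push_cast; field_simp; rw [hTdef]; ring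
    rwa [e1, e2] at g2
  refine InGatedCatHull.mix5
    (c * (2 * q * (1 - q) * s * (c + 1 - T) * (2 + c * s - 2 * s) -
        T * ((1 - q) ^ 2 * (2 + c * s - 2 * s) - 2 * q * (1 - s) ^ 2 * (1 - q * (2 + c * s) / 2))) /
      ((T - 1) * (2 + c * s - 2 * s) * (c + 1 - T)))
    (2 * (c + 1) * q ^ 2 * s * (1 - s) * (1 + c * s - s) / ((2 + c * s - 2 * s) * (T - 1)))
    (q ^ 2 * s ^ 2 * (2 * c + 1) / (T - 1))
    ((c + 1) * ((1 - q) ^ 2 * (2 + c * s - 2 * s) - 2 * q * (1 - s) ^ 2 * (1 - q * (2 + c * s) / 2)) /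
      ((2 + c * s - 2 * s) * (c + 1 - T)))
    (2 * q * (1 - s) ^ 2 / (2 + c * s - 2 * s)) ?_ ?_ ?_ ?_ ?_ ?_ m1 m2 m3 m5 m7 fun h => ?_
  · refine div_nonneg (mul_nonneg hc0'.le ?_) (mul_pos (mul_pos hW hD) hU).le
    rw [hTdef]; linarith
  · have : 0 ≤ 1 + (c : ℝ) * s - s := by nlinarith
    exact div_nonneg (by positivity) (mul_pos hD hW).le
  · exact div_nonneg (by positivity) hW.le
  · exact div_nonneg (mul_nonneg (by positivity) hN5) (mul_pos hD hU).le
  · exact div_nonneg (mul_nonneg (by positivity) (sq_nonneg _)) hD.le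
  · field_simp
    rw [hTdef]
    ring
  · exact lpT_eq_bfLeftMix c q s hc0 hW.ne' hU.ne' hD.ne' hP.ne' h

/-- **… hence at every floor `0 < x ≤ qs`**, with the mean written as the law's own first moment. [this work] -/
theorem lpT_inGatedCatHull_bfLeft_below (c : ℕ) (q s : ℝ) (hc : 1 ≤ c) (hq : 1 / 2 < q) (hq1 : q < 1) (hs0 : 0 < s) (hs1 : s < 1)
    (hT : 2 * q * (1 + c * s) < c + 1) (hB : q * s ≤ 2 * q - 1) (hu : q * (2 + c * s) ≤ 2)
    (hN5 : 0 ≤ (1 - q) ^ 2 * (2 + c * s - 2 * s) - 2 * q * (1 - s) ^ 2 * (1 - q * (2 + c * s) / 2))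
    (hN1 : 0 ≤ 2 * q * (1 - q) * s * (c + 1 - 2 * q * (1 + c * s)) * (2 + c * s - 2 * s) -
      2 * q * (1 + c * s) * ((1 - q) ^ 2 * (2 + c * s - 2 * s) - 2 * q * (1 - s) ^ 2 * (1 - q * (2 + c * s) / 2)))
    (x : ℝ) (hx0 : 0 < x) (hx : x ≤ q * s) :
    InGatedCatHull x (∑ h ∈ Finset.range (2 * c + 2 + 1), (h : ℝ) * lpT c q s h) (2 * c + 2) (lpT c q s) := by
  rw [lpT_mean]
  exact (lpT_inGatedCatHull_bfLeft c q s hc hq hq1 hs0 hs1 hT hB hu hN5 hN1).mono hx0 hx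

/-- **SDEC at the natural floor** on `R_BFleft(c)`. [this work] -/
theorem sdec_lpT_bfLeft (c : ℕ) (q s : ℝ) (hc : 1 ≤ c) (hq : 1 / 2 < q) (hq1 : q < 1) (hs0 : 0 < s) (hs1 : s < 1)
    (hT : 2 * q * (1 + c * s) < c + 1) (hB : q * s ≤ 2 * q - 1) (hu : q * (2 + c * s) ≤ 2)
    (hN5 : 0 ≤ (1 - q) ^ 2 * (2 + c * s - 2 * s) - 2 * q * (1 - s) ^ 2 * (1 - q * (2 + c * s) / 2))
    (hN1 : 0 ≤ 2 * q * (1 - q) * s * (c + 1 - 2 * q * (1 + c * s)) * (2 + c * s - 2 * s) -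
      2 * q * (1 + c * s) * ((1 - q) ^ 2 * (2 + c * s - 2 * s) - 2 * q * (1 - s) ^ 2 * (1 - q * (2 + c * s) / 2))) :
    SDEC (q * s) (2 * c + 2) (lpT c q s) :=
  sdec_of_inGatedCatHull (mul_pos (by linarith) hs0) (lpT_inGatedCatHull_bfLeft c q s hc hq hq1 hs0 hs1 hT hB hu hN5 hN1)

/-- **THE LIGHT NODE ON THESE LAWS**: every tree-built presentation `TreeBuilt x M T` at a floor `x ≤ qs` is in the hull at `x`, its own mean and
its own top. [this work] -/
theorem treeBuiltCatHull_lpT_bfLeft (c : ℕ) (q s : ℝ) (hc : 1 ≤ c) (hq : 1 / 2 < q) (hq1 : q < 1) (hs0 : 0 < s) (hs1 : s < 1)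
    (hT : 2 * q * (1 + c * s) < c + 1) (hB : q * s ≤ 2 * q - 1) (hu : q * (2 + c * s) ≤ 2)
    (hN5 : 0 ≤ (1 - q) ^ 2 * (2 + c * s - 2 * s) - 2 * q * (1 - s) ^ 2 * (1 - q * (2 + c * s) / 2))
    (hN1 : 0 ≤ 2 * q * (1 - q) * s * (c + 1 - 2 * q * (1 + c * s)) * (2 + c * s - 2 * s) -
      2 * q * (1 + c * s) * ((1 - q) ^ 2 * (2 + c * s - 2 * s) - 2 * q * (1 - s) ^ 2 * (1 - q * (2 + c * s) / 2)))
    (x : ℝ) (M : ℕ) (hTB : TreeBuilt x M (lpT c q s)) (hx : x ≤ q * s) :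
    InGatedCatHull x (∑ h ∈ Finset.range (M + 1), (h : ℝ) * lpT c q s h) M (lpT c q s) := by
  obtain ⟨hx0, hM⟩ := lpT_treeBuilt_top c q s (by linarith) hq1.le hs0 hs1.le hTB
  obtain ⟨a, rfl⟩ := Nat.exists_eq_add_of_le hM
  rw [sum_range_extend (fun h => (h : ℝ) * lpT c q s h) (2 * c + 2) a (fun h hh => by rw [lpT_eq_zero c q s h hh, mul_zero]),
    lpT_mean]
  exact ((lpT_inGatedCatHull_bfLeft c q s hc hq hq1 hs0 hs1 hT hB hu hN5 hN1).mono hx0 hx).mono_top hM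

end LawDec
end Quant
end Summit.CriticalPhenomena.PercolationContinuityZ3.Theorems
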